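import Mathlib
import Literature.Probability.Percolation.Percolation
import Literature.Probability.Percolation.RSW
import Literature.Probability.Percolation.PlanarDuality
import Literature.Probability.Percolation.LatticeSymmetry
import Literature.Probability.Percolation.SharpnessDCTProofs
import Literature.Probability.Percolation.DiagonalStripColumns
import Literature.Probability.Percolation.DiagonalColumnPatterns
import Literature.Probability.Percolation.DiagonalStripJunction
import HarnessLib

/-!
# The transfer probabilities of the diagonal percolation strip and the passage probability of a
# finite piece as a pairing of two iterated laws

Topic `Literature/Probability/Percolation`. Probabilistic half (finite volume) of dictionary step
(i) for the named fact `Literature.Probability.Percolation.IkhlefPonsaingFirstPassage`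
(Ikhlef–Ponsaing, J. Stat. Phys. 149 (2012), arXiv:1202.5476). IP12 §3.1: "We take an arbitrary
initial state `|in⟩` and act `N` times with the transfer matrix `t` … When `n = 1` all the
weights are probabilities … The components of `|Ψ⟩` can be thought of as the relative
probabilities of the possible link patterns. In a similar way we define `⟨Ψ|`, the ground state of
the rotated lattice … the expectation value of some observable `𝒪` reads `⟨Ψ|𝒪|Ψ⟩/⟨Ψ|Ψ⟩`";
Def. 4.1: `P_b = ⟨Ψ|ρ|Ψ⟩/⟨Ψ|Ψ⟩`. Here, for bond percolation on `ℤ²` at `p = 1/2`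
(`bondPercolation (zdGraph 2) half`) and the column patterns of `DiagonalColumnPatterns.lean`:

* `layerPairs m c`, `layersPairs m a n` — the finite sets of pairs carrying the edge layers;
  different layers are disjoint; `determinedBy_colUpdate`, `determinedBy_colIter` — locality of the
  update and of the iterated pattern (Grimmett's "events defined in terms of finitely many edges").
* `ipTransfer m c P P'` — **the stochastic transfer matrix** `T_c` (probability that the i.i.d.
  layer `c` updates `P` to `P'`; `sum_ipTransfer`: rows sum to `1`), and `iterLaw m a n` — the law
  `μ_n` of the pattern after `n` layers from the bare column `a`, with `iterLaw_zero` (`μ_0 = δ_in`)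
  and **`iterLaw_succ`** (`μ_{n+1} = μ_n T_{a+n}`, Chapman–Kolmogorov by disjoint-support
  independence, `DCT16.real_inter_of_determinedBy_disjoint`).
* **`real_wall_ipSeg_eq_sum`** — for `a ≤ c ≤ a'`:
  `P_{1/2}(colSite c j ↔ wall in the piece a ≤ x₀-x₁ ≤ a') = ∑_{P,P'} μ_L(P) μ_R(P') J(P, P')` with
  `μ_L = iterLaw m a (c-a)`, `μ_R = iterLaw m (-a') (a'-c)` (the right pattern is the left pattern of
  the transposed configuration, and `P_{1/2}` is transposition invariant,
  `bondPercolation_real_preimage_relabel_iso`) and `J = ipJunction` (IP12's `ρ`): the finite-volume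
  form of `⟨Ψ|ρ|Ψ⟩`.

What remains of the dictionary: the limit `N → ∞` (`tendsto_ipPassage_trunc` of
`IkhlefPonsaingFirstPassageProofs.lean` on the event side; convergence of `μ_n` to the stationary
vector of the two-step chain — Doeblin: an all-closed layer resets the pattern — on the law side),
and the `2`-periodicity of `T_c` in `c`.

## References

* Y. Ikhlef, A. K. Ponsaing, J. Stat. Phys. 149 (2012) 10–36, arXiv:1202.5476, §3.1, Def. 4.1.
  [IkhlefPonsaing2012]
* G. Grimmett, *Percolation*, 2nd ed. (1999), §1.3 (product measure), §2.2 (finitely determined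
  events). [Grimmett1999]
-/

namespace Literature.Probability.Percolation

open Literature.Probability.LatticeModels
open _root_.MeasureTheory

/-! ### Edge layers as finite sets of pairs; locality of the iterated patterns -/

section Layers

/-- The pairs `{colSite c i, colSite (c+1) j}` carrying the edge layer between the columns `c` and
`c + 1` (all `(m+1)²` pairs — a superset of the `2m+1` lattice edges, which is harmless since
non-edges are a.s. closed). [cite: IkhlefPonsaing2012, §3.1] -/
def layerPairs (m : ℕ) (c : ℤ) : Finset (Sym2 (Site 2)) :=
  (Finset.univ : Finset (Fin (m + 1) × Fin (m + 1))).image fun p => s(colSite c p.1, colSite (c + 1) p.2)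

/-- The layer contains its defining pairs. [folklore] -/
theorem mk_mem_layerPairs (m : ℕ) (c : ℤ) (i j : Fin (m + 1)) :
    s(colSite c i, colSite (c + 1) j) ∈ layerPairs m c :=
  Finset.mem_image.2 ⟨(i, j), Finset.mem_univ _, rfl⟩

/-- Membership in a layer. [folklore] -/
theorem mem_layerPairs_iff {m : ℕ} {c : ℤ} {e : Sym2 (Site 2)} :
    e ∈ layerPairs m c ↔ ∃ i j : Fin (m + 1), e = s(colSite c i, colSite (c + 1) j) := by
  simp only [layerPairs, Finset.mem_image, Finset.mem_univ, true_and, Prod.exists]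
  exact ⟨fun ⟨i, j, h⟩ => ⟨i, j, h.symm⟩, fun ⟨i, j, h⟩ => ⟨i, j, h.symm⟩⟩

/-- Different layers are disjoint (a pair of the layer `c` has its lower column at `c`). [folklore] -/
theorem layerPairs_disjoint {m : ℕ} {c c' : ℤ} (h : c ≠ c') : Disjoint (layerPairs m c) (layerPairs m c') := by
  rw [Finset.disjoint_left]
  intro e he he'
  obtain ⟨i, j, rfl⟩ := mem_layerPairs_iff.1 he
  obtain ⟨i', j', h'⟩ := mem_layerPairs_iff.1 he'
  rcases Sym2.eq_iff.1 h' with ⟨h1, -⟩ | ⟨h1, h2⟩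
  · have := congrArg (fun x : Site 2 => x 0 - x 1) h1
    simp only [colSite_sub] at this
    exact h this
  · have e1 := congrArg (fun x : Site 2 => x 0 - x 1) h1
    have e2 := congrArg (fun x : Site 2 => x 0 - x 1) h2
    simp only [colSite_sub] at e1 e2
    omega

/-- The pairs of the `n` layers `a, a+1, …, a+n-1`. [cite: IkhlefPonsaing2012, §3.1] -/
def layersPairs (m : ℕ) (a : ℤ) (n : ℕ) : Finset (Sym2 (Site 2)) :=
  (Finset.range n).biUnion fun k => layerPairs m (a + k)

/-- The first `n` layers are disjoint from the next one. [folklore] -/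
theorem disjoint_layersPairs_layerPairs (m : ℕ) (a : ℤ) (n : ℕ) :
    Disjoint (layersPairs m a n) (layerPairs m (a + n)) := by
  rw [layersPairs, Finset.disjoint_biUnion_left]
  intro k hk
  exact layerPairs_disjoint (by have := Finset.mem_range.1 hk; omega)

/-- Layers below column `c` are disjoint from layers from column `c` on. [folklore] -/
theorem disjoint_layersPairs_of_le {m : ℕ} {a : ℤ} {n : ℕ} {c : ℤ} (hc : a + n ≤ c) {b : ℤ} {n' : ℕ}
    (hb : c ≤ b) : Disjoint (layersPairs m a n) (layersPairs m b n') := by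
  rw [layersPairs, Finset.disjoint_biUnion_left]
  intro k hk
  rw [layersPairs, Finset.disjoint_biUnion_right]
  intro k' hk'
  exact layerPairs_disjoint (by have := Finset.mem_range.1 hk; have := Finset.mem_range.1 hk'; omega)

variable {m : ℕ}

/-- Configurations agreeing on the layer `c` have the same edge layer `colEdges · m c`. [folklore] -/
theorem colEdges_eq_of_forall {ω ω' : BondConfig (Site 2)} {c : ℤ}
    (h : ∀ e ∈ layerPairs m c, e ∈ ω ↔ e ∈ ω') : colEdges ω m c = colEdges ω' m c :=
  colEdges_congr fun i j => h _ (mk_mem_layerPairs m c i j)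

/-- Agreement on a finite set of pairs, from equality of the traces. [folklore] -/
theorem forall_mem_iff_of_inter_eq {ω ω' : BondConfig (Site 2)} {F : Finset (Sym2 (Site 2))}
    (h : ω ∩ ↑F = ω' ∩ ↑F) : ∀ e ∈ F, e ∈ ω ↔ e ∈ ω' := by
  intro e he
  have := Set.ext_iff.1 h e
  simp only [Set.mem_inter_iff, Finset.mem_coe] at this
  exact ⟨fun h1 => (this.1 ⟨h1, he⟩).1, fun h1 => (this.2 ⟨h1, he⟩).1⟩

/-- **Locality of one update**: the event "the layer `c` updates `P` to `P'`" is determined by the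
pairs of the layer `c`. [cite: IkhlefPonsaing2012, §3.1] -/
theorem determinedBy_colUpdate (c : ℤ) (P P' : ColPattern m) :
    DeterminedBy {ω : BondConfig (Site 2) | colUpdate m c P (colEdges ω m c) = P'} ↑(layerPairs m c) := by
  rw [determinedBy_iff]
  intro ω ω' h
  simp only [Set.mem_setOf_eq]
  rw [colEdges_eq_of_forall (forall_mem_iff_of_inter_eq h)]

/-- **Locality of the iterate**: the event "the pattern after `n` layers is `P`" is determined by
the pairs of the first `n` layers. [cite: IkhlefPonsaing2012, §3.1] -/
theorem determinedBy_colIter (a : ℤ) (n : ℕ) (P : ColPattern m) :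
    DeterminedBy {ω : BondConfig (Site 2) | colIter m a (colEdges ω m) n = P} ↑(layersPairs m a n) := by
  rw [determinedBy_iff]
  intro ω ω' h
  simp only [Set.mem_setOf_eq]
  have hk : ∀ k < n, colEdges ω m (a + k) = colEdges ω' m (a + k) := by
    intro k hk
    refine colEdges_eq_of_forall fun e he => forall_mem_iff_of_inter_eq h e ?_
    exact Finset.mem_biUnion.2 ⟨k, Finset.mem_range.2 hk, he⟩
  rw [colIter_congr hk]

end Layers

/-! ### The transfer probabilities and the law of the iterated pattern -/

section Law

open MeasureTheory

variable {m : ℕ}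

/-- **The transfer matrix of the diagonal percolation strip** (IP12 §3.1's `t`, one column at a
time, in the cluster language): `T_c(P, P')` is the probability that the i.i.d. Bernoulli(1/2)
edge layer between columns `c` and `c + 1` updates the pattern `P` to `P'`.
[cite: IkhlefPonsaing2012, §3.1] -/
noncomputable def ipTransfer (m : ℕ) (c : ℤ) (P P' : ColPattern m) : ℝ :=
  (bondPercolation (zdGraph 2) half).real {ω | colUpdate m c P (colEdges ω m c) = P'}

/-- **The law of the pattern after `n` layers** (IP12 §3.1: `t^N |in⟩`): the probability that the
pattern at column `a + n` of the strip truncated at column `a` is `P`. [cite: IkhlefPonsaing2012, §3.1] -/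
noncomputable def iterLaw (m : ℕ) (a : ℤ) (n : ℕ) (P : ColPattern m) : ℝ :=
  (bondPercolation (zdGraph 2) half).real {ω | colIter m a (colEdges ω m) n = P}

/-- The initial law is the Dirac mass at the bare-column pattern. [cite: IkhlefPonsaing2012, §3.1] -/
theorem iterLaw_zero (a : ℤ) (P : ColPattern m) : iterLaw m a 0 P = if colInit m a = P then 1 else 0 := by
  unfold iterLaw
  by_cases h : colInit m a = P
  · rw [if_pos h]
    have : {ω : BondConfig (Site 2) | colIter m a (colEdges ω m) 0 = P} = Set.univ :=
      Set.eq_univ_of_forall fun ω => by simp [colIter, h]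
    rw [this, probReal_univ]
  · rw [if_neg h]
    have : {ω : BondConfig (Site 2) | colIter m a (colEdges ω m) 0 = P} = ∅ :=
      Set.eq_empty_of_forall_notMem fun ω hω => h (by simpa [colIter] using hω)
    rw [this, measureReal_empty]

/-- **The Chapman–Kolmogorov step** `μ_{n+1} = μ_n T_{a+n}`: the layer `a + n` is independent of
the first `n` layers (disjoint sets of pairs, product measure), and the pattern after `n + 1`
layers is the update of the pattern after `n` layers. [cite: IkhlefPonsaing2012, §3.1] -/
theorem iterLaw_succ (a : ℤ) (n : ℕ) (P' : ColPattern m) :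
    iterLaw m a (n + 1) P' = ∑ P : ColPattern m, iterLaw m a n P * ipTransfer m (a + n) P P' := by
  classical
  set μ := bondPercolation (zdGraph 2) half with hμ
  have hdec : {ω : BondConfig (Site 2) | colIter m a (colEdges ω m) (n + 1) = P'} =
      ⋃ P ∈ (Finset.univ : Finset (ColPattern m)),
        ({ω | colIter m a (colEdges ω m) n = P} ∩ {ω | colUpdate m (a + n) P (colEdges ω m (a + n)) = P'}) := by
    ext ω
    simp only [Set.mem_setOf_eq, Finset.mem_univ, Set.iUnion_true, Set.mem_iUnion, Set.mem_inter_iff]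
    constructor
    · intro h
      exact ⟨_, rfl, by simpa [colIter] using h⟩
    · rintro ⟨P, hP, h⟩
      simp only [colIter, hP]
      exact h
  unfold iterLaw
  rw [hdec, measureReal_biUnion_finset]
  · refine Finset.sum_congr rfl fun P _ => ?_
    exact DCT16.real_inter_of_determinedBy_disjoint (zdGraph 2) half (determinedBy_colIter a n P)
      (determinedBy_colUpdate (a + n) P P') (disjoint_layersPairs_layerPairs m a n)
  · intro P _ Q _ hPQ
    refine Set.disjoint_left.2 fun ω h1 h2 => hPQ ?_
    exact h1.1.symm.trans h2.1
  · intro P _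
    exact ((determinedBy_colIter a n P).measurableSet_of_finset).inter
      ((determinedBy_colUpdate (a + n) P P').measurableSet_of_finset)

/-- Transfer probabilities are nonnegative. [folklore] -/
theorem ipTransfer_nonneg (c : ℤ) (P P' : ColPattern m) : 0 ≤ ipTransfer m c P P' := measureReal_nonneg

/-- **`T_c` is stochastic**: `∑_{P'} T_c(P, P') = 1`. [cite: IkhlefPonsaing2012, §3.1] -/
theorem sum_ipTransfer (c : ℤ) (P : ColPattern m) : ∑ P' : ColPattern m, ipTransfer m c P P' = 1 := by
  classical
  have hdec : (Set.univ : Set (BondConfig (Site 2))) =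
      ⋃ P' ∈ (Finset.univ : Finset (ColPattern m)), {ω | colUpdate m c P (colEdges ω m c) = P'} := by
    ext ω
    simp
  have h := (probReal_univ (μ := bondPercolation (zdGraph 2) half)).symm
  rw [hdec, measureReal_biUnion_finset] at h
  · exact h.symm
  · intro P₁ _ P₂ _ h12
    exact Set.disjoint_left.2 fun ω h1 h2 => h12 (h1.symm.trans h2)
  · intro P' _
    exact (determinedBy_colUpdate c P P').measurableSet_of_finset

/-- Iterated laws are nonnegative. [folklore] -/
theorem iterLaw_nonneg (a : ℤ) (n : ℕ) (P : ColPattern m) : 0 ≤ iterLaw m a n P := measureReal_nonneg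

/-- Iterated laws are probability vectors. [folklore] -/
theorem sum_iterLaw (a : ℤ) (n : ℕ) : ∑ P : ColPattern m, iterLaw m a n P = 1 := by
  classical
  have hdec : (Set.univ : Set (BondConfig (Site 2))) =
      ⋃ P ∈ (Finset.univ : Finset (ColPattern m)), {ω | colIter m a (colEdges ω m) n = P} := by
    ext ω
    simp
  have h := (probReal_univ (μ := bondPercolation (zdGraph 2) half)).symm
  rw [hdec, measureReal_biUnion_finset] at h
  · exact h.symm
  · intro P₁ _ P₂ _ h12
    exact Set.disjoint_left.2 fun ω h1 h2 => h12 (h1.symm.trans h2)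
  · intro P _
    exact (determinedBy_colIter a n P).measurableSet_of_finset

end Law

/-! ### The passage probability of a finite piece as a pairing of two iterated laws -/

section Pairing

open MeasureTheory

variable {m : ℕ}

/-- The transposed configuration of a lattice configuration is a lattice configuration. [folklore] -/
theorem relabel_transpose_subset_edgeSet {ω : BondConfig (Site 2)} (hω : ω ⊆ (zdGraph 2).edgeSet) :
    BondConfig.relabel (sym2Equiv (transposeIso : zdGraph 2 ≃g zdGraph 2).toEquiv) ω ⊆
      (zdGraph 2).edgeSet := by
  intro z hz
  rw [BondConfig.mem_relabel_iff, sym2Equiv_symm] at hz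
  exact (sym2Equiv_mem_edgeSet_iff (transposeIso : zdGraph 2 ≃g zdGraph 2).symm z).1 (hω hz)

/-- The transposition, as the inverse of `transposeIso.toEquiv`, is `transposeIso` itself. [folklore] -/
theorem coe_transposeIso_toEquiv_symm :
    (((transposeIso : zdGraph 2 ≃g zdGraph 2).toEquiv.symm : Site 2 ≃ Site 2) : Site 2 → Site 2) =
      (transposeIso : Site 2 → Site 2) :=
  funext fun z => transposeIso_symm_apply z

/-- Pairs of the transposed right layers lie in layers from the seam on. [folklore] -/
theorem exists_mem_layerPairs_of_mem_image_transpose {a' : ℤ} {n : ℕ} {e : Sym2 (Site 2)}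
    (he : e ∈ (layersPairs m (-a') n).image (Sym2.map transposeIso)) :
    ∃ k < n, e ∈ layerPairs m (a' - k - 1) := by
  obtain ⟨e', he', rfl⟩ := Finset.mem_image.1 he
  obtain ⟨k, hk, hk'⟩ := Finset.mem_biUnion.1 he'
  obtain ⟨i, j, rfl⟩ := mem_layerPairs_iff.1 hk'
  refine ⟨k, Finset.mem_range.1 hk, ?_⟩
  rw [Sym2.map_mk, transposeIso_colSite, transposeIso_colSite, Sym2.eq_swap,
    show -(-a' + (k : ℤ) + 1) = a' - k - 1 by ring, show -(-a' + (k : ℤ)) = a' - k - 1 + 1 by ring]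
  exact mk_mem_layerPairs m _ j i

/-- Left layers (below the seam `c`) and transposed right layers (from the seam on) are disjoint.
[folklore] -/
theorem disjoint_layersPairs_image_transpose {a c a' : ℤ} {nL nR : ℕ} (hL : a + nL ≤ c)
    (hR : (nR : ℤ) ≤ a' - c) :
    Disjoint (layersPairs m a nL) ((layersPairs m (-a') nR).image (Sym2.map transposeIso)) := by
  rw [Finset.disjoint_left]
  intro e heL heR
  obtain ⟨k, hk, hke⟩ := exists_mem_layerPairs_of_mem_image_transpose heR
  obtain ⟨k', hk', hk'e⟩ := Finset.mem_biUnion.1 heL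
  have hk'' := Finset.mem_range.1 hk'
  have hne : a + (k' : ℤ) ≠ a' - k - 1 := by omega
  exact Finset.disjoint_left.1 (layerPairs_disjoint (m := m) hne) hk'e hke

/-- **Locality is transported by the transposition**: if `A` is determined by `F`, then
"the transposed configuration lies in `A`" is determined by the transposed pairs. [folklore] -/
theorem determinedBy_preimage_relabel_transpose {A : Set (BondConfig (Site 2))}
    {F : Finset (Sym2 (Site 2))} (hA : DeterminedBy A ↑F) :
    DeterminedBy ((BondConfig.relabel (sym2Equiv (transposeIso : zdGraph 2 ≃g zdGraph 2).toEquiv)) ⁻¹' A)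
      ↑(F.image (Sym2.map transposeIso)) := by
  classical
  rw [determinedBy_iff] at hA ⊢
  intro ω ω' h
  simp only [Set.mem_preimage]
  apply hA
  have key : ∀ z ∈ F, (z ∈ BondConfig.relabel (sym2Equiv (transposeIso : zdGraph 2 ≃g zdGraph 2).toEquiv) ω ↔
      z ∈ BondConfig.relabel (sym2Equiv (transposeIso : zdGraph 2 ≃g zdGraph 2).toEquiv) ω') := by
    intro z hz
    rw [BondConfig.mem_relabel_iff, BondConfig.mem_relabel_iff, sym2Equiv_symm, sym2Equiv_apply,
      coe_transposeIso_toEquiv_symm]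
    exact forall_mem_iff_of_inter_eq h _ (Finset.mem_image_of_mem _ hz)
  ext z
  simp only [Set.mem_inter_iff, Finset.mem_coe]
  exact ⟨fun ⟨h1, h2⟩ => ⟨(key z h2).1 h1, h2⟩, fun ⟨h1, h2⟩ => ⟨(key z h2).2 h1, h2⟩⟩

/-- **The passage probability of a finite piece is a pairing of two iterated laws**
(IP12 Def. 4.1, `P_b = ⟨Ψ|ρ|Ψ⟩/⟨Ψ|Ψ⟩`, in finite volume and in the cluster language): for
`a ≤ c ≤ a'`, the probability that the seam site `colSite c j` is joined to the wall inside the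
piece `a ≤ x₀ - x₁ ≤ a'` equals `∑_{P, P'} μ_L(P) μ_R(P') J(P, P')`, where `μ_L = iterLaw m a (c - a)`
is the law of the left pattern (`c - a` layers from the bare column `a`), `μ_R = iterLaw m (-a') (a' - c)`
that of the transposed right pattern, and `J` the junction functional. Ingredients: the
deterministic dictionary (`wall_ipSeg_iff_ipJunction`, `colPattern_eq_colIter`) on lattice
configurations (a.s.), independence of the two sides (disjoint pairs), and invariance of
`P_{1/2}` under the transposition. [cite: IkhlefPonsaing2012, §3.1, Def. 4.1] -/
theorem real_wall_ipSeg_eq_sum (m : ℕ) {a c a' : ℤ} (hac : a ≤ c) (hca : c ≤ a') (j : Fin (m + 1)) :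
    (bondPercolation (zdGraph 2) half).real
        {ω | ∃ w : Site 2, w 0 + w 1 = 0 ∧ ω ∈ openConnIn (ipSeg m a a') (colSite c j) w} =
      ∑ P : ColPattern m, ∑ P' : ColPattern m,
        iterLaw m a (c - a).toNat P * iterLaw m (-a') (a' - c).toNat P' *
          (if ipJunction m j P P' = true then 1 else 0) := by
  classical
  set nL := (c - a).toNat with hnL
  set nR := (a' - c).toNat with hnR
  have hcL : a + (nL : ℤ) = c := by rw [hnL, Int.toNat_of_nonneg (by omega)]; ring
  have hcR : -a' + (nR : ℤ) = -c := by rw [hnR, Int.toNat_of_nonneg (by omega)]; ring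
  have hnR' : (nR : ℤ) ≤ a' - c := by rw [hnR, Int.toNat_of_nonneg (by omega)]
  -- Step 1: a.s. identification of the event with the junction of the two iterated patterns
  have step1 : (bondPercolation (zdGraph 2) half).real
      {ω | ∃ w : Site 2, w 0 + w 1 = 0 ∧ ω ∈ openConnIn (ipSeg m a a') (colSite c j) w} =
      (bondPercolation (zdGraph 2) half).real
        {ω | ipJunction m j (colIter m a (colEdges ω m) nL)
          (colIter m (-a') (colEdges (BondConfig.relabel
            (sym2Equiv (transposeIso : zdGraph 2 ≃g zdGraph 2).toEquiv) ω) m) nR) = true} := by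
    refine DCT16.real_congr_of_forall_subset_edgeSet (zdGraph 2) half fun ω hω => ?_
    simp only [Set.mem_setOf_eq]
    rw [wall_ipSeg_iff_ipJunction hω m hac hca j]
    have h1 := colPattern_eq_colIter hω m a nL
    rw [hcL] at h1
    have h2 := colPattern_eq_colIter (relabel_transpose_subset_edgeSet hω) m (-a') nR
    rw [hcR] at h2
    rw [h1, h2]
  -- Step 2: decomposition over the pairs of patterns
  have hdec : {ω : BondConfig (Site 2) | ipJunction m j (colIter m a (colEdges ω m) nL)
        (colIter m (-a') (colEdges (BondConfig.relabel
          (sym2Equiv (transposeIso : zdGraph 2 ≃g zdGraph 2).toEquiv) ω) m) nR) = true} =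
      ⋃ q ∈ (Finset.univ.filter fun q : ColPattern m × ColPattern m => ipJunction m j q.1 q.2 = true),
        ({ω | colIter m a (colEdges ω m) nL = q.1} ∩
          (BondConfig.relabel (sym2Equiv (transposeIso : zdGraph 2 ≃g zdGraph 2).toEquiv)) ⁻¹'
            {ω | colIter m (-a') (colEdges ω m) nR = q.2}) := by
    ext ω
    simp only [Set.mem_setOf_eq, Finset.mem_filter, Finset.mem_univ, true_and, Set.mem_iUnion,
      Set.mem_inter_iff, Set.mem_preimage, exists_prop]
    constructor
    · intro h
      exact ⟨(_, _), h, rfl, rfl⟩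
    · rintro ⟨q, hJ, h1, h2⟩
      rw [h1, h2]
      exact hJ
  have hterm : ∀ q : ColPattern m × ColPattern m,
      (bondPercolation (zdGraph 2) half).real ({ω | colIter m a (colEdges ω m) nL = q.1} ∩
          (BondConfig.relabel (sym2Equiv (transposeIso : zdGraph 2 ≃g zdGraph 2).toEquiv)) ⁻¹'
            {ω | colIter m (-a') (colEdges ω m) nR = q.2}) =
        iterLaw m a nL q.1 * iterLaw m (-a') nR q.2 := by
    intro q
    rw [DCT16.real_inter_of_determinedBy_disjoint (zdGraph 2) half (determinedBy_colIter a nL q.1)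
      (determinedBy_preimage_relabel_transpose (determinedBy_colIter (-a') nR q.2))
      (disjoint_layersPairs_image_transpose (le_of_eq hcL) hnR')]
    unfold iterLaw
    rw [bondPercolation_real_preimage_relabel_iso]
  rw [step1, hdec, measureReal_biUnion_finset]
  · rw [Finset.sum_filter, Fintype.sum_prod_type]
    refine Finset.sum_congr rfl fun P _ => Finset.sum_congr rfl fun P' _ => ?_
    split_ifs with hJ
    · rw [hterm, mul_one]
    · rw [mul_zero]
  · intro q _ q' _ hqq'
    refine Set.disjoint_left.2 fun ω h1 h2 => hqq' ?_
    exact Prod.ext (h1.1.symm.trans h2.1) (h1.2.symm.trans h2.2)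
  · intro q _
    exact (determinedBy_colIter a nL q.1).measurableSet_of_finset.inter
      (determinedBy_preimage_relabel_transpose (determinedBy_colIter (-a') nR q.2)).measurableSet_of_finset

end Pairing

end Literature.Probability.Percolation
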